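import Summits.CriticalPhenomena.PercolationContinuityZ3.Theorems.PercNearOneGluingAdditiveGluingSetObserverMetaA2
import Summits.CriticalPhenomena.PercolationContinuityZ3.Theorems.PercNearOneGluingNoHeavyLowerTailCovTauHtwWorld
import HarnessLib

/-!
# Conjecture G / SET-W via a SET observer, XVIII: (Htw-set) in world-sum form

Support file (`--supports stmt-CriticalPhenomena-4576`); no definitions, no named facts, no sorries.  Seat (b) V⁺-form `png-dp-vplus`, gen 13
(memo MEMO-gen12.md §4(d), §10 (H)).  Set-observer version of `CSH.htw_world` (`…AdditiveGluingCSHHtwBridge.lean`): the diagonal of META-A2 for the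
killed set observer on the whole graph (`CovTau.p1HSet_univ`) rewritten in the world-sum vocabulary of the unfolding (`CSH.wcovOff`,
`CSH.wmeanOff`, worlds = delete the pairs meeting the open vertex cluster of `Y`; NO zeroed-weight measures in the statement, so that the
consumer `…SetObserverUnfoldMain.lean` — which lives in a different decidability-instance context — can use it verbatim).
* dictionary: `EavSet_univ_eq`, `BfS_rest_univ_eq_wcovOff`, `EavSet_rest_univ_eq`, `Mav_rest_univ_eq`, `live_rest_univ_eq`;
* **`htw_set_sum`** — for `x ∈ S`, `v ∉ S`, `g` monotone `≥ 0`, every `Y` and every observer set `O`: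
  `μ({O~v} ∩ {O ≁ S∪Y}) · Σ_ω w 1{x↮Y} Cov_ω(g(C_x), 1{v↔S}) ≤ μ(v ↮ S∪Y) · Σ_ω w 1{x↮Y} ℓ(ω) q_ω Cov_ω(g(C_x), 1{v↔S})`,
  `ℓ(ω) = 1{∀ o ∈ O, o ↮ Y}`, `q_ω = μ_ω(O~v, O≁S)/μ_ω(v↮S)` (world means `wmeanOff`).
[cite: VandenbergHaggstromKahn2005, Thm. 1.1 (pp. 3–5), Thm. 1.4 (p. 7), §2.1 Lemmas 2.3–2.4 (p. 10)] [cite: Gladkov2024, Thm. 3.2 (p. 4)]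
[cite: KozmaNitzan2024, Conj. 4 (p. 32)]
-/

noncomputable section

namespace Summit.CriticalPhenomena.PercolationContinuityZ3.Theorems.CovTau

open MeasureTheory Set
open Literature.Probability.LatticeModels (prodBernoulli)
open Literature.Probability.Percolation
open Literature.Probability.Percolation.BHK2006 (weight edgesIn rC rD weight_nonneg)
open Literature.Probability.Percolation.DecisionTree (ind ind_of_mem ind_of_not_mem ind_nonneg)
open CSH HullPort
open scoped Classical

variable {V : Type*} [Fintype V]

/-- `E^O_S(Y)` on the whole graph is `μ({O ~ v} ∩ {O ≁ S ∪ Y})`. [cite: VandenbergHaggstromKahn2005, §1 p. 3] -/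
theorem EavSet_univ_eq (p : Sym2 V → unitInterval) (S : Set V) (O : Finset V) (v : V) (Y : Set V) :
    EavSet (fun e => (p e : ℝ)) Finset.univ S O v Y =
      (prodBernoulli p).real ({ω : BondConfig V | ∃ o ∈ O, (openGraph ω).Reachable o v} ∩
        {ω | ∀ o ∈ O, ∀ a ∈ S ∪ Y, ¬ (openGraph ω).Reachable o a}) := by
  unfold EavSet
  simp only [inter_edgesIn_univ]
  exact sum_weight_ind p _

/-- **`H^S` in the world `G ∖ C_Y(ω)` is the world covariance `Cov_ω(g(C_x), 1{v ↔ S})`** (sum vocabulary `CSH.wcovOff`).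
[cite: VandenbergHaggstromKahn2005, §2.1 Lemmas 2.3–2.4 (p. 10)] -/
theorem BfS_rest_univ_eq_wcovOff (w : Sym2 V → ℝ) (x v : V) (S : Finset V) (Y : Set V) (g : Set (Sym2 V) → ℝ) (ω : Set (Sym2 V)) :
    BfS w (rest Finset.univ Y ω) x (↑S : Set V) v g =
      wcovOff w Y (fun β => g (openEdgeCluster β x)) (ind (⋃ t ∈ S, (openConn v t : Set (BondConfig V)))) ω := by
  unfold BfS tfE cfS wcovOff wmeanOff
  have hC : ∀ η : Set (Sym2 V), rC (rest Finset.univ Y ω) x η = openEdgeCluster (η \ cut Y ω) x := by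
    intro η; rw [rC, inter_edgesIn_rest_univ_set]
  have hI : ∀ η : Set (Sym2 V),
      ind {ζ : Set (Sym2 V) | ∃ s ∈ (↑S : Set V), (openGraph (ζ ∩ edgesIn (rest Finset.univ Y ω))).Reachable s v} η =
        ind (⋃ t ∈ S, (openConn v t : Set (BondConfig V))) (η \ cut Y ω) := by
    intro η; rw [ind_reach_inter, inter_edgesIn_rest_univ_set]
  simp only [hC, hI]

/-- `E^O_S(∅)` in the world `G ∖ C_Y(ω)` is the world mean of `1{O ~ v}·1{O ≁ S}`. [cite: VandenbergHaggstromKahn2005, §2.1 Lemmas 2.3–2.4 (p. 10)] -/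
theorem EavSet_rest_univ_eq (w : Sym2 V → ℝ) (S : Finset V) (O : Finset V) (v : V) (Y : Set V) (ω : Set (Sym2 V)) :
    EavSet w (rest Finset.univ Y ω) (↑S : Set V) O v ∅ =
      wmeanOff w Y (ind ({ζ : Set (Sym2 V) | ∃ o ∈ O, (openGraph ζ).Reachable o v} ∩
        {ζ | ∀ o ∈ O, ∀ a ∈ S, ¬ (openGraph ζ).Reachable o a})) ω := by
  unfold EavSet wmeanOff
  refine Finset.sum_congr rfl fun η _ => ?_
  congr 1
  have hiff : η ∈ ({ω' : Set (Sym2 V) | ∃ o ∈ O, (openGraph (ω' ∩ edgesIn (rest Finset.univ Y ω))).Reachable o v} ∩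
      {ω' | ∀ o ∈ O, ∀ a ∈ (↑S : Set V) ∪ ∅, ¬ (openGraph (ω' ∩ edgesIn (rest Finset.univ Y ω))).Reachable o a}) ↔
      (η \ cut Y ω) ∈ ({ζ : Set (Sym2 V) | ∃ o ∈ O, (openGraph ζ).Reachable o v} ∩
        {ζ | ∀ o ∈ O, ∀ a ∈ S, ¬ (openGraph ζ).Reachable o a}) := by
    simp only [inter_edgesIn_rest_univ_set, mem_inter_iff, mem_setOf_eq, union_empty, Finset.mem_coe]
  by_cases h : η ∈ ({ω' : Set (Sym2 V) | ∃ o ∈ O, (openGraph (ω' ∩ edgesIn (rest Finset.univ Y ω))).Reachable o v} ∩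
      {ω' | ∀ o ∈ O, ∀ a ∈ (↑S : Set V) ∪ ∅, ¬ (openGraph (ω' ∩ edgesIn (rest Finset.univ Y ω))).Reachable o a})
  · rw [ind_of_mem h, ind_of_mem (hiff.1 h)]
  · rw [ind_of_not_mem h, ind_of_not_mem (fun h' => h (hiff.2 h'))]

/-- `M_S(∅)` in the world `G ∖ C_Y(ω)` is the world mean of `1{v ↮ S}`. [cite: VandenbergHaggstromKahn2005, §2.1 Lemmas 2.3–2.4 (p. 10)] -/
theorem Mav_rest_univ_eq (w : Sym2 V → ℝ) (S : Finset V) (v : V) (Y : Set V) (ω : Set (Sym2 V)) :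
    Mav w (rest Finset.univ Y ω) (↑S : Set V) v ∅ =
      wmeanOff w Y (ind {ζ : Set (Sym2 V) | ∀ t ∈ S, ¬ (openGraph ζ).Reachable v t}) ω := by
  unfold Mav wmeanOff rD
  refine Finset.sum_congr rfl fun η _ => ?_
  congr 1
  have hiff : η ∈ {ω' : Set (Sym2 V) | ∀ x ∈ (↑S : Set V) ∪ ∅, ¬ (openGraph (ω' ∩ edgesIn (rest Finset.univ Y ω))).Reachable v x} ↔
      (η \ cut Y ω) ∈ {ζ : Set (Sym2 V) | ∀ t ∈ S, ¬ (openGraph ζ).Reachable v t} := by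
    simp only [inter_edgesIn_rest_univ_set, mem_setOf_eq, union_empty, Finset.mem_coe]
  by_cases h : η ∈ {ω' : Set (Sym2 V) | ∀ x ∈ (↑S : Set V) ∪ ∅, ¬ (openGraph (ω' ∩ edgesIn (rest Finset.univ Y ω))).Reachable v x}
  · rw [ind_of_mem h, ind_of_mem (hiff.1 h)]
  · rw [ind_of_not_mem h, ind_of_not_mem (fun h' => h (hiff.2 h'))]

/-- **The liveness factor**: `1{O ⊆ V ∖ C_Y(ω)} = 1{∀ o ∈ O, o ↮ Y}(ω)`. [folklore] -/
theorem live_rest_univ_eq (O : Finset V) (Y : Set V) (ω : Set (Sym2 V)) :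
    (if O ⊆ rest Finset.univ Y ω then (1 : ℝ) else 0) = ind {β : Set (Sym2 V) | ∀ o ∈ O, β ∈ avoidEv o Y} ω := by
  have hiff : O ⊆ rest Finset.univ Y ω ↔ ω ∈ {β : Set (Sym2 V) | ∀ o ∈ O, β ∈ avoidEv o Y} := by
    simp only [mem_setOf_eq]
    constructor
    · intro h o ho y hy hoy
      have := (mem_rest.1 (h ho)).2
      exact this (mem_sC_univ.2 ⟨y, hy, hoy.symm⟩)
    · intro h o ho
      refine mem_rest.2 ⟨Finset.mem_univ o, fun hC => ?_⟩
      obtain ⟨y, hy, hyo⟩ := mem_sC_univ.1 hC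
      exact h o ho y hy hyo.symm
  by_cases h : O ⊆ rest Finset.univ Y ω
  · rw [if_pos h, ind_of_mem (hiff.1 h)]
  · rw [if_neg h, ind_of_not_mem (fun h' => h (hiff.2 h'))]

/-- **(Htw-set) in world-sum form** (memo §4(d)): for `x ∈ S`, `v ∉ S`, `g` monotone `≥ 0`, every `Y` and every observer set `O`,
`μ({O~v} ∩ {O ≁ S∪Y}) · Σ_ω w(ω) 1{x↮Y}(ω) Cov_ω(g(C_x), 1{v↔S}) ≤ μ(v ↮ S∪Y) · Σ_ω w(ω) 1{x↮Y}(ω) ℓ(ω) q_ω Cov_ω(g(C_x), 1{v↔S})`,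
`ℓ(ω) = 1{∀ o ∈ O, o ↮ Y}`, `q_ω = μ_ω(O~v, O≁S)/μ_ω(v↮S)` — the set version of `CSH.htw_world`, from `CovTau.p1HSet_univ`.
[cite: VandenbergHaggstromKahn2005, Thm. 1.1 (pp. 3–5), Thm. 1.4 (p. 7)] [cite: Gladkov2024, Thm. 3.2 (p. 4)] -/
theorem htw_set_sum (w : Sym2 V → unitInterval) (x : V) (Y : Set V) (S : Finset V) (hxS : x ∈ S) (O : Finset V) (v : V) (hvS : v ∉ S)
    (g : Set (Sym2 V) → ℝ) (hg : Monotone g) (hg0 : ∀ C, 0 ≤ g C) :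
    (prodBernoulli w).real ({ω : BondConfig V | ∃ o ∈ O, (openGraph ω).Reachable o v} ∩
        {ω | ∀ o ∈ O, ∀ a ∈ (↑S : Set V) ∪ Y, ¬ (openGraph ω).Reachable o a}) *
      ∑ ω, weight (fun e => (w e : ℝ)) ω * (ind (avoidEv x Y) ω *
        wcovOff (fun e => (w e : ℝ)) Y (fun β => g (openEdgeCluster β x)) (ind (⋃ t ∈ S, (openConn v t : Set (BondConfig V)))) ω) ≤
    (prodBernoulli w).real {ω : BondConfig V | ∀ a ∈ (↑S : Set V) ∪ Y, ¬ (openGraph ω).Reachable v a} *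
      ∑ ω, weight (fun e => (w e : ℝ)) ω * (ind (avoidEv x Y) ω *
        (ind {β : Set (Sym2 V) | ∀ o ∈ O, β ∈ avoidEv o Y} ω *
          (wmeanOff (fun e => (w e : ℝ)) Y (ind ({ζ : Set (Sym2 V) | ∃ o ∈ O, (openGraph ζ).Reachable o v} ∩
              {ζ | ∀ o ∈ O, ∀ a ∈ S, ¬ (openGraph ζ).Reachable o a})) ω /
            wmeanOff (fun e => (w e : ℝ)) Y (ind {ζ : Set (Sym2 V) | ∀ t ∈ S, ¬ (openGraph ζ).Reachable v t}) ω) *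
          wcovOff (fun e => (w e : ℝ)) Y (fun β => g (openEdgeCluster β x)) (ind (⋃ t ∈ S, (openConn v t : Set (BondConfig V)))) ω)) := by
  set w' : Sym2 V → ℝ := fun e => (w e : ℝ) with hw'
  have hw0 : ∀ e, 0 ≤ w' e := fun e => (w e).2.1
  have hw1 : ∀ e, w' e ≤ 1 := fun e => (w e).2.2
  have hm : ∑ ω, weight w' ω = 1 := sum_weight_coe_eq_one w
  have key := p1HSet_univ w' hw0 hw1 hm (S := (↑S : Set V)) (Finset.mem_coe.2 hxS) (fun h => hvS (Finset.mem_coe.1 h)) O hg hg0 Y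
  -- translate the four functionals
  have hE := EavSet_univ_eq w (↑S : Set V) O v Y
  have hM := Mav_univ_eq w v S Y
  have hY : Yw w' Finset.univ x (fun U' => BfS w' U' x (↑S : Set V) v g) Y =
      ∑ ω, weight w' ω * (ind (avoidEv x Y) ω *
        wcovOff w' Y (fun β => g (openEdgeCluster β x)) (ind (⋃ t ∈ S, (openConn v t : Set (BondConfig V)))) ω) := by
    rw [Yw]
    refine Finset.sum_congr rfl fun ω _ => ?_
    rw [BfS_rest_univ_eq_wcovOff, rD_univ_eq_avoidEv, mul_comm (wcovOff _ _ _ _ _)]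
  have hX : Yw w' Finset.univ x (fun U' => qavSet w' U' (↑S : Set V) O v * BfS w' U' x (↑S : Set V) v g) Y =
      ∑ ω, weight w' ω * (ind (avoidEv x Y) ω *
        (ind {β : Set (Sym2 V) | ∀ o ∈ O, β ∈ avoidEv o Y} ω *
          (wmeanOff w' Y (ind ({ζ : Set (Sym2 V) | ∃ o ∈ O, (openGraph ζ).Reachable o v} ∩
              {ζ | ∀ o ∈ O, ∀ a ∈ S, ¬ (openGraph ζ).Reachable o a})) ω /
            wmeanOff w' Y (ind {ζ : Set (Sym2 V) | ∀ t ∈ S, ¬ (openGraph ζ).Reachable v t}) ω) *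
          wcovOff w' Y (fun β => g (openEdgeCluster β x)) (ind (⋃ t ∈ S, (openConn v t : Set (BondConfig V)))) ω)) := by
    rw [Yw]
    refine Finset.sum_congr rfl fun ω _ => ?_
    rw [qavSet, BfS_rest_univ_eq_wcovOff, rD_univ_eq_avoidEv, live_rest_univ_eq, EavSet_rest_univ_eq, Mav_rest_univ_eq]
    ring
  rw [hE, hY, hM, hX] at key
  simpa only [hw'] using key

end Summit.CriticalPhenomena.PercolationContinuityZ3.Theorems.CovTau

end
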